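import Literature.AlgebraicGeometry.Hu2025.Statements.S07GammaSchemes.R109aGamma
import Mathlib.AlgebraicGeometry.Properties
import HarnessLib

/-!
# Hu 2025 (arXiv:2507.21400v1) §7.1: the carrier-level hypothesis `ZGammaIntegral` («Assume that Z_Γ is integral», Lem. 7.3
# C57L80; the J1 = G-H7 standing hypothesis of row 109, file `R109aGamma.lean`) IS integrality of the affine scheme
# `Z_Γ = Spec (𝔽[x_u] ⧸ I_{℘,Γ})` (equivalently: `I_{℘,Γ}` is prime) — the glue to the scheme-level statements of row 110
# (Def. 8.4 / Thm. 8.5–8.6 / Thm. 1.3)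

**Honest framing (D-0012/D-0089).** A kernel fact about OUR typed carrier (`GammaSchemeRing` = Def. 7.1, `ZGammaIntegral`),
via Mathlib's `AlgebraicGeometry.affine_isIntegral_iff` («`Spec R` is integral iff `R` is a domain»); nothing of [Hu2025]
(arXiv:2507.21400v1, `paper:arxiv-2507.21400`, UNREFEREED, under adjudication at rung M-Hu-min of the campaign `res-hironaka`)
is asserted. Provenance: res-type-016 (typer of record of row 109).
-/

noncomputable section

namespace Literature.AlgebraicGeometry.Hu2025.Statements.S07GammaSchemes

open _root_.AlgebraicGeometry

universe u

variable {σ : Type u} {𝔽 : Type u} [Field 𝔽]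

/-- **«Z_Γ is integral» at carrier level ⟺ `I_{℘,Γ}` is a prime ideal of `𝔽[x_u]`** (Mathlib
`Ideal.Quotient.isDomain_iff_prime`). [cite: Hu2025, Def. 7.1 C57L14–L23 and Lem. 7.3 C57L80; p.128–129 (unrefereed manuscript under adjudication — kernel fact about the typed carrier, nothing of the manuscript asserted)] -/
theorem zGammaIntegral_iff_isPrime (𝔉 : Set (MvPolynomial σ 𝔽)) (Γ : Set σ) :
    ZGammaIntegral 𝔉 Γ ↔ (gammaWpIdeal 𝔉 Γ).IsPrime :=
  Ideal.Quotient.isDomain_iff_prime (gammaWpIdeal 𝔉 Γ)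

/-- **«Z_Γ is integral» at carrier level ⟺ the affine scheme `Z_Γ = Spec (𝔽[x_u] ⧸ I_{℘,Γ})` is an integral scheme**
(Def. 7.1: «Z_Γ … the closed subscheme of the affine space 𝐔 defined by the ideal I_{℘,Γ}», C57L19–L23; the hypothesis
«Assume that Z_Γ is integral», C57L80 / C59L146 / C62L132). Mathlib `affine_isIntegral_iff`.
[cite: Hu2025, Def. 7.1 C57L19–L23 and Lem. 7.3 C57L80; p.128–129 (unrefereed manuscript under adjudication — kernel fact about the typed carrier, nothing of the manuscript asserted)] -/
theorem zGammaIntegral_iff_isIntegral_spec (𝔉 : Set (MvPolynomial σ 𝔽)) (Γ : Set σ) :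
    ZGammaIntegral 𝔉 Γ ↔ IsIntegral (Spec (.of (GammaSchemeRing 𝔉 Γ))) :=
  (affine_isIntegral_iff (.of (GammaSchemeRing 𝔉 Γ))).symm

/-- In particular `Z_Γ` integral (carrier level) makes `Spec (𝔽[x] ⧸ I_{℘,Γ})` an integral scheme (instance form for row 110).
[cite: Hu2025, Lem. 7.3 C57L80 «Assume that Z_Γ is integral»; p.129 (unrefereed manuscript under adjudication — kernel fact about the typed carrier, nothing asserted)] -/
theorem isIntegral_spec_of_zGammaIntegral {𝔉 : Set (MvPolynomial σ 𝔽)} {Γ : Set σ} (h : ZGammaIntegral 𝔉 Γ) :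
    IsIntegral (Spec (.of (GammaSchemeRing 𝔉 Γ))) :=
  (zGammaIntegral_iff_isIntegral_spec 𝔉 Γ).mp h

end Literature.AlgebraicGeometry.Hu2025.Statements.S07GammaSchemes

end
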